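import Literature.Computability.Cryptography.CsidhActionUniqueProofs
import Literature.Computability.Cryptography.CsidhActionNormalFormProofs
import Literature.Computability.Cryptography.CsidhActionKernelsProofs
import Literature.NumberTheory.EllipticCurves.IsogenyVariableChangeProofs
import HarnessLib

/-!
# The CSIDH class-group action: existence of the act-result for labels with odd `a`

Sibling *proofs* file (theorems only, D-0014/D-0026) of
`Literature.Computability.Cryptography.CsidhAction`, working towards the named fact
`csidh_classGroupAction` (Castryck–Lange–Martindale–Panny–Renes, *CSIDH*, ASIACRYPT 2018, §3
Lemma 6 and Thm. 7, §5 Prop. 8). It proves the **existence half of clause (1)** for labels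
`f = (a, b, c)` with `a` odd: for `p ≡ 3 (mod 8)` and a valid `A` there is a valid `A'` reached
from `E_A` by an `𝔽_p`-isogeny with kernel `E_A[𝔞_f]`:

* `exists_point_addOrderOf_eq_four`: a valid `E_A` has an `𝔽_p`-rational point of order `4`
  (`(1, √(A+2))` or `(-1, √(A-2))`: exactly one of `A ± 2` is a square since `A² - 4` is not,
  by the floor lemma `no_root_of_isCoeff`);
* `exists_isActResult_of_odd`: the separable quotient `g : E_A → E' = E_A/E_A[𝔞_f]`
  (`exists_quotient_idealKernel`) carries it to an `𝔽_p`-rational point of `E'` of order `4`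
  (an element of order `2` of the kernel `E_A[𝔞_f] ⊆ E_A[a]`, `a` odd, is zero; Frobenius-fixed
  points of `E'(𝔽̄_p)` are `𝔽_p`-rational, the tree's `smul_eq_self_iff_mem_range_toGeomPoints`);
  so `E'` has a Montgomery model `E_{A'}` over `𝔽_p`
  (`exists_variableChange_eq_curve_of_addOrderOf_eq_four`), reached from `E_A` by
  `(E' ≅ E_{A'}) ∘ g`, an `𝔽_p`-isogeny with kernel `E_A[𝔞_f]`; `A'` is valid (`A'² ≠ 4`, and
  `#E_{A'}(𝔽_p) = p + 1` by `natCard_point_eq_of_isogeny`).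

The case of even `a` (where `E_A[𝔞_f]` meets the `2`-torsion) is not treated here.

## References

* [CastryckEtAl2018] W. Castryck, T. Lange, C. Martindale, L. Panny, J. Renes, *CSIDH*,
  ASIACRYPT 2018, §3 Lemma 6, Thm. 7, §5 Prop. 8 (proof, `⇒`: "a separable `𝔽_p`-isogeny … of
  odd degree. Thus … there exists an `A ∈ 𝔽_p` and a separable isogeny `ψ : E₀ → E_A` … we
  conclude that `E` is `𝔽_p`-isomorphic to `E_A`").
* [SilvermanAEC2009] J. H. Silverman, *The Arithmetic of Elliptic Curves*, 2nd ed., III.4.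

## Design

`noncomputable section`, `open scoped Classical`; theorems only, no definitions, no new named
facts.
-/

noncomputable section

open scoped Classical

namespace Literature.Computability.Cryptography.Csidh

open Literature.NumberTheory.QuadraticFields.Quadratic
open Literature.NumberTheory.QuadraticFields.Quadratic.BinQF
open WeierstrassCurve

universe u

/-- The order of a rational point equals that of its image in `E(K̄)` (`E(K) ↪ E(K̄)` is an
injective homomorphism). Stated over a general field, with the group law of `E(K)` read under the
classical decidability instances of the tree's `toGeomPoints`. [folklore] -/
theorem addOrderOf_toGeomPoints {K : Type u} [Field K] (W : WeierstrassCurve K) (P : W.toAffine.Point) :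
    addOrderOf (W.toGeomPoints P) = addOrderOf P :=
  addOrderOf_injective W.toGeomPoints W.toGeomPoints_injective P

variable {p : ℕ} [Fact p.Prime]

/-! ### A rational point of order `4` on a valid `E_A` -/

/-- **Doubling `(-1, y₁)` on `E_A`**: if `y₁² = A - 2 ≠ 0` then `2 · (-1, y₁) = (0, 0)` (tangent
slope `(3 - 2A + 1)/(2y₁) = -y₁`, `x(2P) = y₁² - A + 2 = 0`). [folklore] -/
theorem add_self_some_neg_one (hp8 : p % 8 = 3) {A y₁ : ZMod p}
    (h₁ : (curve p A).toAffine.Nonsingular (-1) y₁) (hy : y₁ ≠ 0)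
    (h₀ : (curve p A).toAffine.Nonsingular 0 0) :
    (WeierstrassCurve.Affine.Point.some (-1) y₁ h₁) + (WeierstrassCurve.Affine.Point.some (-1) y₁ h₁) =
      WeierstrassCurve.Affine.Point.some 0 0 h₀ := by
  have hA2 : y₁ ^ 2 = A - 2 := by
    have := (Affine.equation_iff _ _).mp h₁.1
    simp only [curve] at this
    linear_combination this
  have h2 := two_ne_zero_zmod hp8
  have hneg : y₁ ≠ (curve p A).toAffine.negY (-1) y₁ := by
    simp only [WeierstrassCurve.Affine.negY, curve]
    intro h
    apply hy
    have : 2 * y₁ = 0 := by linear_combination h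
    simpa [h2] using this
  have hden : y₁ - (curve p A).toAffine.negY (-1) y₁ ≠ 0 := sub_ne_zero.2 hneg
  have hslope : (curve p A).toAffine.slope (-1) (-1) y₁ y₁ = -y₁ := by
    rw [WeierstrassCurve.Affine.slope_of_Y_ne rfl hneg, div_eq_iff hden]
    simp only [WeierstrassCurve.Affine.negY, curve]
    linear_combination (2 : ZMod p) * hA2
  rw [WeierstrassCurve.Affine.Point.add_self_of_Y_ne hneg,
    WeierstrassCurve.Affine.Point.some.injEq, hslope]
  simp only [WeierstrassCurve.Affine.addY, WeierstrassCurve.Affine.negAddY,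
    WeierstrassCurve.Affine.addX, WeierstrassCurve.Affine.negY, curve]
  constructor
  · linear_combination hA2
  · linear_combination y₁ * hA2

/-- For a valid `A`, one of `A + 2`, `A - 2` is a square in `𝔽_p` (their product `A² - 4` is not,
since `x² + Ax + 1` has no root in `𝔽_p`, `no_root_of_isCoeff`). [folklore] -/
theorem isSquare_add_two_or_sub_two (hp8 : p % 8 = 3) {A : ZMod p} (hA : IsCoeff p A) :
    IsSquare (A + 2) ∨ IsSquare (A - 2) := by
  have h2 := two_ne_zero_zmod hp8
  have hnr := no_root_of_isCoeff hp8 hA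
  -- `A² - 4` is not a square
  have hns : ¬ IsSquare (A ^ 2 - 4) := by
    rintro ⟨δ, hδ⟩
    apply hnr ((-A + δ) / 2)
    field_simp
    linear_combination -hδ
  by_contra h
  rw [not_or] at h
  obtain ⟨h₁, h₂⟩ := h
  have hA2 : A + 2 ≠ 0 := fun h0 ↦ hA.1 (by
    have : A = -2 := by linear_combination h0
    rw [this]; norm_num)
  have hA2' : A - 2 ≠ 0 := fun h0 ↦ hA.1 (by
    have : A = 2 := by linear_combination h0
    rw [this]; norm_num)
  have c₁ : quadraticChar (ZMod p) (A + 2) = -1 := quadraticChar_neg_one_iff_not_isSquare.2 h₁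
  have c₂ : quadraticChar (ZMod p) (A - 2) = -1 := quadraticChar_neg_one_iff_not_isSquare.2 h₂
  apply hns
  rw [← quadraticChar_one_iff_isSquare (by
    rw [show A ^ 2 - 4 = (A + 2) * (A - 2) by ring]; exact mul_ne_zero hA2 hA2'),
    show A ^ 2 - 4 = (A + 2) * (A - 2) by ring, map_mul, c₁, c₂]
  norm_num

/-- **A valid `E_A` has an `𝔽_p`-rational point of order `4`**: `(1, √(A+2))` or `(-1, √(A-2))`,
whose double is the point `(0, 0)` of order `2` (CSIDH §5: the floor curves `E_A`, `p ≡ 3 (mod 8)`,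
have `E_A(𝔽_p)[2^∞] ≅ ℤ/4`). [cite: CastryckEtAl2018, §5 Prop. 8 (proof)] -/
theorem exists_point_addOrderOf_eq_four (hp8 : p % 8 = 3) {A : ZMod p} (hA : IsCoeff p A) :
    ∃ P : (curve p A).toAffine.Point, addOrderOf P = 4 := by
  haveI := isElliptic_of_isCoeff hp8 hA
  have e₀ : (curve p A).toAffine.Equation 0 0 := (equation_zero_iff 0).2 (by ring)
  have n₀ := (WeierstrassCurve.Affine.equation_iff_nonsingular (W := (curve p A).toAffine)).1 e₀
  have hT₀2 : (Affine.Point.some 0 0 n₀ : (curve p A).toAffine.Point) + Affine.Point.some 0 0 n₀ = 0 :=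
    add_self_some_zero n₀
  have hT₀ne : (Affine.Point.some 0 0 n₀ : (curve p A).toAffine.Point) ≠ 0 :=
    WeierstrassCurve.Affine.Point.some_ne_zero n₀
  -- from `P + P = T₀` the order is `4`
  have key : ∀ P : (curve p A).toAffine.Point, P + P = Affine.Point.some 0 0 n₀ → addOrderOf P = 4 := by
    intro P hPP
    have : addOrderOf P = 2 ^ (1 + 1) := by
      refine addOrderOf_eq_prime_pow (fun h ↦ hT₀ne ?_) ?_
      · rwa [pow_one, two_nsmul, hPP] at h
      · rw [show 2 ^ (1 + 1) = 2 + 2 from rfl, add_nsmul, two_nsmul, hPP, hT₀2]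
    rw [this]
    norm_num
  rcases isSquare_add_two_or_sub_two hp8 hA with ⟨y₁, hy₁⟩ | ⟨y₁, hy₁⟩
  · have hy0 : y₁ ≠ 0 := by
      rintro rfl
      apply hA.1
      have : A = -2 := by linear_combination hy₁
      rw [this]; norm_num
    have eP : (curve p A).toAffine.Equation 1 y₁ := (equation_one_iff y₁).2 (by rw [hy₁]; ring)
    have nP := (WeierstrassCurve.Affine.equation_iff_nonsingular (W := (curve p A).toAffine)).1 eP
    exact ⟨_, key _ (add_self_some_one hp8 nP hy0 n₀)⟩
  · have hy0 : y₁ ≠ 0 := by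
      rintro rfl
      apply hA.1
      have : A = 2 := by linear_combination hy₁
      rw [this]; norm_num
    have eP : (curve p A).toAffine.Equation (-1) y₁ := by
      rw [WeierstrassCurve.Affine.equation_iff]
      simp only [curve]
      linear_combination -hy₁
    have nP := (WeierstrassCurve.Affine.equation_iff_nonsingular (W := (curve p A).toAffine)).1 eP
    exact ⟨_, key _ (add_self_some_neg_one hp8 nP hy0 n₀)⟩

/-! ### Transfer through the quotient isogeny -/

/-- An element of `E_A[𝔞_f] ⊆ E_A[a]` killed by `2` is zero when `a` is odd (`gcd(a, 2) = 1`).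
[folklore] -/
theorem eq_zero_of_mem_idealKernel_of_two_nsmul {f : BinQF} (hodd : Odd f.a) {A : ZMod p}
    {P : (curve p A).geomPoints} (hP : P ∈ idealKernel p f A) (h2 : (2 : ℕ) • P = 0) : P = 0 := by
  obtain ⟨k, hk⟩ := hodd
  have ha : f.a • P = 0 := ((mem_idealKernel_iff P).1 hP).1
  have h2' : (2 : ℤ) • P = 0 := by rw [show (2 : ℤ) = ((2 : ℕ) : ℤ) from rfl, natCast_zsmul, h2]
  have : P = f.a • P - k • ((2 : ℤ) • P) := by
    rw [hk]
    module
  rw [this, ha, h2', smul_zero, sub_zero]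

/-- **Existence of the act-result for odd `a`.** For `p ≡ 3 (mod 8)`, a form `f = (a, b, c)` with
`a` odd (not necessarily reduced) and a valid coefficient `A`, there is a valid `A'` reached from
`E_A` by an `𝔽_p`-isogeny with kernel `E_A[𝔞_f]`: compose the separable quotient
`g : E_A → E_A/E_A[𝔞_f] = E'` (CSIDH Lemma 6, `exists_quotient_idealKernel`) with an
`𝔽_p`-isomorphism onto a Montgomery model of `E'`, which exists because `E'` inherits from `E_A`
an `𝔽_p`-rational point of order `4` (CSIDH §5: the class-group action stays in
`Ell_p(ℤ[π], π)`, whose members have Montgomery form, Prop. 8 `⇒`).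
[cite: CastryckEtAl2018, §3 Lemma 6 and Thm. 7, §5 Prop. 8] -/
theorem exists_isActResult_of_odd (hp8 : p % 8 = 3) {f : BinQF}
    (hodd : Odd f.a) {A : ZMod p} (hA : IsCoeff p A) : ∃ A' : ZMod p, IsActResult p f A A' := by
  haveI := isElliptic_of_isCoeff hp8 hA
  haveI : NeZero p := ⟨(Fact.out : p.Prime).ne_zero⟩
  have ha0 : f.a ≠ 0 := fun h ↦ by
    rw [h] at hodd
    exact Int.not_odd_iff_even.mpr ⟨0, by simp⟩ hodd
  obtain ⟨W', hW', g, hker, -⟩ := exists_quotient_idealKernel' hp8 ha0 hA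
  haveI := hW'
  -- a rational point of order `4` on `E_A`, as a geometric point
  obtain ⟨P₄, hP₄⟩ := exists_point_addOrderOf_eq_four hp8 hA
  set Q : (curve p A).geomPoints := (curve p A).toGeomPoints P₄ with hQ
  have hQord : addOrderOf Q = 4 := by
    rw [hQ, addOrderOf_toGeomPoints]
    convert hP₄
  -- its image `R = g Q` has order `4`
  set R : W'.geomPoints := g Q with hR
  have h4Q : (4 : ℕ) • Q = 0 := by rw [← hQord]; exact addOrderOf_nsmul_eq_zero Q
  have h2Q : (2 : ℕ) • Q ≠ 0 := fun h ↦ by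
    have := addOrderOf_dvd_of_nsmul_eq_zero h
    rw [hQord] at this
    omega
  have h2R : (2 : ℕ) • R ≠ 0 := by
    intro h
    rw [hR, ← map_nsmul] at h
    have hmem : (2 : ℕ) • Q ∈ idealKernel p f A := by
      rw [← hker, AddMonoidHom.mem_ker]
      exact h
    exact h2Q (eq_zero_of_mem_idealKernel_of_two_nsmul hodd hmem
      (by rw [← mul_nsmul', show 2 * 2 = 4 from rfl, h4Q]))
  have h4R : (4 : ℕ) • R = 0 := by rw [hR, ← map_nsmul, h4Q, map_zero]
  have hRord : addOrderOf R = 4 := by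
    have : addOrderOf R = 2 ^ (1 + 1) :=
      addOrderOf_eq_prime_pow (by rwa [pow_one]) (by rw [show 2 ^ (1 + 1) = 4 from rfl, h4R])
    rw [this]
    norm_num
  -- `R` is `𝔽_p`-rational
  have hfrob : ∀ x : AlgebraicClosure (ZMod p), frob p • x = x ^ Nat.card (ZMod p) :=
    frob_smul_eq_pow_card
  have hRfix : frob p • R = R := by
    rw [hR, ← Isogeny.map_smul, hQ, smul_toGeomPoints]
  obtain ⟨R₀, hR₀⟩ := (smul_eq_self_iff_mem_range_toGeomPoints hfrob R).mp hRfix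
  have hR₀ord : addOrderOf R₀ = 4 := by
    have h := addOrderOf_toGeomPoints W' R₀
    rw [hR₀, hRord] at h
    convert h.symm
  -- Montgomery model of `E'`
  obtain ⟨A', C, hC⟩ := exists_variableChange_eq_curve_of_addOrderOf_eq_four hp8 W' R₀ hR₀ord
  have hA'4 : A' ^ 2 ≠ 4 := sq_ne_four_of_smul_eq_curve hC
  haveI hE' : (curve p A').IsElliptic := isElliptic_curve p (by omega) hA'4
  -- the isogeny `E_A → E_{A'}` with kernel `E_A[𝔞_f]`
  have hφ : ∃ φ : (curve p A).Isogeny (curve p A'), φ.toAddMonoidHom.ker = idealKernel p f A := by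
    suffices h : ∀ (V : WeierstrassCurve (ZMod p)) (ι : W'.Isogeny V), Function.Injective ι →
        V = curve p A' → ∃ φ : (curve p A).Isogeny (curve p A'),
          φ.toAddMonoidHom.ker = idealKernel p f A from
      h _ (VariableChange.toIsogeny W' C) (VariableChange.toIsogeny_injective W' C) hC
    rintro V ι hι rfl
    refine ⟨ι.comp g, ?_⟩
    rw [← hker]
    ext P
    rw [AddMonoidHom.mem_ker, AddMonoidHom.mem_ker, Isogeny.coe_toAddMonoidHom,
      Isogeny.coe_toAddMonoidHom, Isogeny.comp_apply]
    constructor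
    · intro h
      exact hι (h.trans (map_zero ι).symm)
    · intro h
      rw [h, map_zero]
  obtain ⟨φ, hφker⟩ := hφ
  refine ⟨A', ⟨hA'4, natCard_point_eq_of_isogeny hp8 hA φ⟩, φ, hφker⟩

/-- In particular `act p f A` is the act-result and is valid, for labels with odd `a`.
[cite: CastryckEtAl2018, §3 Thm. 7, §5 Prop. 8] -/
theorem existsUnique_isActResult_of_odd (hp8 : p % 8 = 3) {f : BinQF} (hf : IsLabel (-(p : ℤ)) f)
    (hodd : Odd f.a) {A : ZMod p} (hA : IsCoeff p A) : ∃! A' : ZMod p, IsActResult p f A A' :=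
  existsUnique_isActResult_of_exists hp8 hf hA (exists_isActResult_of_odd hp8 hodd hA)

end Literature.Computability.Cryptography.Csidh
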